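import Summits.BirchSwinnertonDyer.BirchSwinnertonDyer.Theorems.CyclotomicUntwistKatzFrobeniusModVarpi
import Literature.NumberTheory.EllipticCurves.FormalGroupInvariantDifferentialProofs
import Literature.NumberTheory.EllipticCurves.FormalGroupNegProofs
import Literature.NumberTheory.EllipticCurves.FormalGroupLawAxiomsUniversalProofs
import Literature.AlgebraicGeometry.Resolution.MvPowerSeriesChainRule
import Mathlib.RingTheory.PowerSeries.Expand
import Mathlib.FieldTheory.Finite.Basic
import HarnessLib

/-!
# Route `CyclotomicUntwist`: endomorphisms of the formal group of a Weierstrass curve — AEC IV.4.3 in `η`-form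
# (`h′·η = h′(0)·η(h)`) and, in characteristic `p`, «`h′(0) = 0` ⟹ `h = g(Xᵖ)` with `g` again an endomorphism»

Cell `pub/bsd-wall` (D-0145 line `route-BirchSwinnertonDyer-CyclotomicUntwist`), prover seat `bsd-line-cycu-p3`
(gen 8), lane «KATZ FROBENIUS MOD ϖ», memo `Cruxes/PSRankOneLowerHalfAtThree/KATZ-FROBENIUS-MOD-VARPI-v2.md`, work
package W3 («`End_{𝔽₃⟦X⟧}(F̄) = ℤ₃[π]`»): the digit map `h ↦ h′(0)` on the endomorphisms of the reduced formal group has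
kernel `π ∘ End`, `π = (X ↦ Xᵖ)`. THEOREMS ONLY (no definition, no named fact, no `sorry`); helper `--supports` K1 =
stmt-BirchSwinnertonDyer-21580 (K2 = 21581; print child C2 = 27549 / 27616). BSD is not proved by this file and no
crux is. An "endomorphism" of the chord–tangent law `F = formalGroupLaw W` is written out as a series `h ∈ R⟦X⟧`,
`h(0) = 0`, with `h(F(X,Y)) = F(h(X), h(Y))` in `R⟦X,Y⟧` (no definition is introduced).

* §1 `derivative_mul_formalEta_of_hom` — **AEC IV.4.3 for endomorphisms, over any commutative ring**:
  `h′(X)·η(X) = h′(0)·η(h(X))` (`η = dX/ω = formalEta = F_X(0,X)`): differentiate the homomorphism identity with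
  respect to `X` (chain rule, `MvPowerSeriesChainRule`) and put `X = 0` (`F_X(0,T) = η(T)`,
  `FormalGroupInvariantDifferentialProofs.subst_zero_X_pderiv_formalGroupLaw`).
* §2 (characteristic `p`, `W` over `ZMod p`) `eq_expand_of_derivative_eq_zero` (`f′ = 0 ⟹ f = g(Xᵖ)`),
  `derivative_eq_zero_of_hom` (`h′(0) = 0 ⟹ h′ = 0`, as `η` is a unit), **`exists_hom_expand_of_coeff_one_eq_zero`**
  (`h′(0) = 0 ⟹ h = g(Xᵖ)` with `g(F(X,Y)) = F(g(X), g(Y))`, using `F(X,Y)ᵖ = F(Xᵖ,Yᵖ)` over `𝔽_p`).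
[cite: SilvermanAEC2009, IV.4.3 and IV.7 (proof of Thm. 7.4)] [cite: Katz1981CrystallineDieudonne, §5.3]
-/

set_option autoImplicit false
-- single-conjunct summit: `Summit.BirchSwinnertonDyer.BirchSwinnertonDyer.…` repeats the name by design
set_option linter.dupNamespace false

noncomputable section

open PowerSeries Literature.NumberTheory.EllipticCurves
open Literature.AlgebraicGeometry.Resolution (MvPowerSeries.pderiv MvPowerSeries.coeff_pderiv
  MvPowerSeries.pderiv_X MvPowerSeries.pderiv_C MvPowerSeries.pderiv_powerSeries_subst
  MvPowerSeries.pderiv_powerSeries_subst_X MvPowerSeries.pderiv_subst_pair)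

namespace Summit.BirchSwinnertonDyer.BirchSwinnertonDyer.Theorems.FormalEndomorphism

/-! ## §1 AEC IV.4.3 for endomorphisms: `h′·η = h′(0)·η(h)` -/

section AnyRing

variable {R : Type*} [CommRing R] (W : WeierstrassCurve R)

omit W in
/-- `f(X) = f`. [folklore] -/
theorem subst_X_self' (f : R⟦X⟧) : f.subst (PowerSeries.X : R⟦X⟧) = f := by
  rw [← PowerSeries.map_algebraMap_eq_subst_X, Algebra.algebraMap_self, PowerSeries.map_id, id]

/-- `G(0, h(T)) = (G(0, T))(h(T))`: substituting `(0, h)` is substituting `(0, X)` and then `X ↦ h`. [folklore] -/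
theorem subst_zero_pair_eq_subst (G : MvPowerSeries (Fin 2) R) {h : R⟦X⟧} (hh : constantCoeff h = 0) :
    MvPowerSeries.subst ![(0 : R⟦X⟧), h] G =
      PowerSeries.subst h (MvPowerSeries.subst ![(0 : R⟦X⟧), PowerSeries.X] G) := by
  have hs := WeierstrassCurve.hasSubst_zero_X (R := R)
  have hh' : PowerSeries.HasSubst h := PowerSeries.HasSubst.of_constantCoeff_zero' hh
  rw [PowerSeries.subst, MvPowerSeries.subst_comp_subst_apply hs hh'.const]
  congr 1
  funext i
  fin_cases i
  · simp only [Fin.zero_eta, Matrix.cons_val_zero]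
    rw [← MvPowerSeries.coe_substAlgHom hh'.const, map_zero]
  · simp only [Fin.mk_one, Matrix.cons_val_one, Matrix.cons_val_zero]
    exact (PowerSeries.subst_X (R := R) hh').symm

/-- **AEC IV.4.3 for an endomorphism of `Ê`, `η`-form, over any commutative ring.** If `h ∈ R⟦X⟧`, `h(0) = 0`,
satisfies `h(F(X,Y)) = F(h(X), h(Y))` for the chord–tangent law `F`, then `h′(X)·η(X) = h′(0)·η(h(X))` with
`η = F_X(0, X) = dX/ω` — i.e. `ω(h)·dh = h′(0)·ω`. Proof: `∂/∂X` of the identity and `X = 0`.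
[cite: SilvermanAEC2009, IV.4.3] -/
theorem derivative_mul_formalEta_of_hom {h : R⟦X⟧} (hh0 : constantCoeff h = 0)
    (hh : h.subst W.formalGroupLaw =
      MvPowerSeries.subst ![h.subst (MvPowerSeries.X 0 : MvPowerSeries (Fin 2) R),
        h.subst (MvPowerSeries.X 1 : MvPowerSeries (Fin 2) R)] W.formalGroupLaw) :
    d⁄dX R h * W.formalEta = PowerSeries.C (coeff 1 h) * W.formalEta.subst h := by
  classical
  set F := W.formalGroupLaw with hF
  have hF0 : MvPowerSeries.constantCoeff F = 0 := W.constantCoeff_formalGroupLaw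
  have hA0 : MvPowerSeries.constantCoeff (h.subst (MvPowerSeries.X 0 : MvPowerSeries (Fin 2) R)) = 0 :=
    constantCoeff_powerSeries_subst_eq_zero (MvPowerSeries.constantCoeff_X 0) hh0
  have hB0 : MvPowerSeries.constantCoeff (h.subst (MvPowerSeries.X 1 : MvPowerSeries (Fin 2) R)) = 0 :=
    constantCoeff_powerSeries_subst_eq_zero (MvPowerSeries.constantCoeff_X 1) hh0
  -- differentiate with respect to `X₀`
  have hd := congrArg (MvPowerSeries.pderiv 0) hh
  rw [MvPowerSeries.pderiv_powerSeries_subst hF0, MvPowerSeries.pderiv_subst_pair hA0 hB0,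
    MvPowerSeries.pderiv_powerSeries_subst_X, MvPowerSeries.pderiv_powerSeries_subst_X, if_pos rfl,
    if_neg (by decide), mul_zero, add_zero] at hd
  -- put `X₀ = 0`, `X₁ = X`
  have hs := WeierstrassCurve.hasSubst_zero_X (R := R)
  have hT := congrArg (MvPowerSeries.subst ![(0 : R⟦X⟧), PowerSeries.X]) hd
  rw [MvPowerSeries.subst_mul hs, MvPowerSeries.subst_mul hs, mvSubst_powerSeries_subst W.hasSubst_formalGroupLaw hs,
    W.formalGroupLaw_subst_zero_X, W.subst_zero_X_pderiv_formalGroupLaw, subst_X_self'] at hT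
  -- `(d/dX h)(0) = coeff 1 h`
  have hc : (d⁄dX R h).constantCoeff = coeff 1 h := by
    rw [← coeff_zero_eq_constantCoeff_apply, coeff_derivative, zero_add, Nat.cast_zero, zero_add, mul_one]
  have hlast : MvPowerSeries.subst ![(0 : R⟦X⟧), PowerSeries.X]
      ((d⁄dX R h).subst (MvPowerSeries.X 0 : MvPowerSeries (Fin 2) R)) = PowerSeries.C (coeff 1 h) := by
    rw [mvSubst_powerSeries_subst (PowerSeries.HasSubst.X 0) hs, WeierstrassCurve.subst_zero_X_X_zero,
      PowerSeries.subst_zero_eq_C_constantCoeff, hc, MvPowerSeries.map_C]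
    rfl
  -- the pair `(h(X₀), h(X₁))` at `X₀ = 0`, `X₁ = X` is `(0, h)`
  have hpair : MvPowerSeries.subst ![(0 : R⟦X⟧), PowerSeries.X]
      (MvPowerSeries.subst ![h.subst (MvPowerSeries.X 0 : MvPowerSeries (Fin 2) R),
        h.subst (MvPowerSeries.X 1 : MvPowerSeries (Fin 2) R)] (MvPowerSeries.pderiv 0 F)) =
      W.formalEta.subst h := by
    rw [MvPowerSeries.subst_comp_subst_apply (WeierstrassCurve.hasSubst_pair hA0 hB0) hs,
      ← W.subst_zero_X_pderiv_formalGroupLaw, ← subst_zero_pair_eq_subst _ hh0]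
    congr 1
    funext i
    fin_cases i
    · simp only [Fin.zero_eta, Matrix.cons_val_zero]
      rw [mvSubst_powerSeries_subst (PowerSeries.HasSubst.X 0) hs, WeierstrassCurve.subst_zero_X_X_zero,
        PowerSeries.subst_zero_of_constantCoeff_zero hh0]
    · simp only [Fin.mk_one, Matrix.cons_val_one, Matrix.cons_val_zero]
      rw [mvSubst_powerSeries_subst (PowerSeries.HasSubst.X 1) hs, WeierstrassCurve.subst_zero_X_X_one,
        subst_X_self']
  rw [hpair, hlast] at hT
  rw [hT]
  ring

end AnyRing

/-! ## §2 Characteristic `p`: `h′(0) = 0` forces `h = g(Xᵖ)` with `g` an endomorphism -/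

section CharP

variable {p : ℕ} [hp : Fact p.Prime] (E : WeierstrassCurve (ZMod p))

omit E in
/-- In characteristic `p`, a series with zero derivative is a series in `Xᵖ`. [folklore] -/
theorem eq_expand_of_derivative_eq_zero {f : (ZMod p)⟦X⟧} (hf : d⁄dX (ZMod p) f = 0) :
    f = expand p hp.out.ne_zero (PowerSeries.mk fun n ↦ coeff (p * n) f) := by
  ext n
  rw [coeff_expand]
  split_ifs with h
  · obtain ⟨m, rfl⟩ := h
    rw [coeff_mk, Nat.mul_div_cancel_left m hp.out.pos]
  · -- `n` is prime to `p`, so `n · f_n = 0` forces `f_n = 0`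
    rcases n with _ | k
    · exact absurd (dvd_zero p) h
    · have hk := congrArg (coeff k) hf
      rw [coeff_derivative, map_zero] at hk
      have hu : IsUnit ((k + 1 : ℕ) : ZMod p) := by
        rw [ZMod.isUnit_iff_coprime]
        exact (Nat.coprime_comm.mp ((Nat.Prime.coprime_iff_not_dvd hp.out).mpr h))
      have : coeff (k + 1) f * ((k : ZMod p) + 1) = 0 := by exact_mod_cast hk
      rw [show ((k : ZMod p) + 1) = ((k + 1 : ℕ) : ZMod p) by push_cast; ring] at this
      exact (hu.mul_left_eq_zero).mp this

/-- **`h′(0) = 0` ⟹ `h′ = 0`** for an endomorphism in characteristic `p` (`h′η = h′(0)η(h)` and `η` is a unit).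
[cite: SilvermanAEC2009, IV.4.3 and IV.7.4] -/
theorem derivative_eq_zero_of_hom {h : (ZMod p)⟦X⟧} (hh0 : constantCoeff h = 0)
    (hh : h.subst E.formalGroupLaw =
      MvPowerSeries.subst ![h.subst (MvPowerSeries.X 0 : MvPowerSeries (Fin 2) (ZMod p)),
        h.subst (MvPowerSeries.X 1 : MvPowerSeries (Fin 2) (ZMod p))] E.formalGroupLaw)
    (h1 : coeff 1 h = 0) : d⁄dX (ZMod p) h = 0 := by
  have key := derivative_mul_formalEta_of_hom E hh0 hh
  rw [h1, map_zero, zero_mul] at key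
  have hu : IsUnit E.formalEta := by
    rw [PowerSeries.isUnit_iff_constantCoeff, E.constantCoeff_formalEta]; exact isUnit_one
  exact (hu.mul_left_eq_zero).mp key

omit hp in
/-- Over `𝔽_p` the `p`-th power of a two-variable series is its expansion: `G(X,Y)ᵖ = G(Xᵖ,Yᵖ)`. [folklore] -/
theorem pow_prime_eq_expand [Fact p.Prime] (G : MvPowerSeries (Fin 2) (ZMod p)) :
    G ^ p = MvPowerSeries.expand p (Nat.Prime.ne_zero Fact.out) G := by
  have h := MvPowerSeries.map_frobenius_expand p (Nat.Prime.ne_zero Fact.out) (f := G)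
  rw [ZMod.frobenius_zmod, MvPowerSeries.map_id] at h
  exact h.symm

/-- **`h′(0) = 0` ⟹ `h = g(Xᵖ)` with `g` again an endomorphism** (characteristic `p`, `F̄` defined over `𝔽_p`):
`h = g(Xᵖ)` by `derivative_eq_zero_of_hom`, and `g(F̄(X,Y))(Xᵖ,Yᵖ) = g(F̄(X,Y)ᵖ) = h(F̄) = F̄(h,h) =
F̄(g,g)(Xᵖ,Yᵖ)`, so `g` is a homomorphism since `(X,Y) ↦ (Xᵖ,Yᵖ)` is injective on series. The digit map
`h ↦ h′(0)` on `End(F̄)` thus has kernel `π ∘ End(F̄)`, `π = Frobenius`. [cite: SilvermanAEC2009, IV.7 (Thm. 7.4, proof)]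
[cite: Katz1981CrystallineDieudonne, §5.3] -/
theorem exists_hom_expand_of_coeff_one_eq_zero {h : (ZMod p)⟦X⟧} (hh0 : constantCoeff h = 0)
    (hh : h.subst E.formalGroupLaw =
      MvPowerSeries.subst ![h.subst (MvPowerSeries.X 0 : MvPowerSeries (Fin 2) (ZMod p)),
        h.subst (MvPowerSeries.X 1 : MvPowerSeries (Fin 2) (ZMod p))] E.formalGroupLaw)
    (h1 : coeff 1 h = 0) :
    ∃ g : (ZMod p)⟦X⟧, constantCoeff g = 0 ∧ h = expand p hp.out.ne_zero g ∧
      g.subst E.formalGroupLaw =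
        MvPowerSeries.subst ![g.subst (MvPowerSeries.X 0 : MvPowerSeries (Fin 2) (ZMod p)),
          g.subst (MvPowerSeries.X 1 : MvPowerSeries (Fin 2) (ZMod p))] E.formalGroupLaw := by
  classical
  set g : (ZMod p)⟦X⟧ := PowerSeries.mk fun n ↦ coeff (p * n) h with hgdef
  have hg : h = expand p hp.out.ne_zero g := eq_expand_of_derivative_eq_zero (derivative_eq_zero_of_hom E hh0 hh h1)
  have hg0 : constantCoeff g = 0 := by
    rw [← coeff_zero_eq_constantCoeff_apply, hgdef, coeff_mk, mul_zero, coeff_zero_eq_constantCoeff_apply, hh0]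
  refine ⟨g, hg0, hg, ?_⟩
  set F := E.formalGroupLaw with hF
  have hF0 : MvPowerSeries.constantCoeff F = 0 := E.constantCoeff_formalGroupLaw
  have hp0 : p ≠ 0 := hp.out.ne_zero
  have hgs : PowerSeries.HasSubst g := PowerSeries.HasSubst.of_constantCoeff_zero' hg0
  have hX : ∀ i : Fin 2, MvPowerSeries.constantCoeff (MvPowerSeries.X i : MvPowerSeries (Fin 2) (ZMod p)) = 0 :=
    fun i ↦ MvPowerSeries.constantCoeff_X i
  -- both sides of the homomorphism identity for `h`, rewritten as expansions
  have hL : h.subst F = MvPowerSeries.expand p hp0 (g.subst F) := by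
    rw [hg, Summit.BirchSwinnertonDyer.BirchSwinnertonDyer.Theorems.KatzFrobenius.expand_subst_eq hF0 p hp0,
      pow_prime_eq_expand, PowerSeries.subst, PowerSeries.subst,
      MvPowerSeries.expand_subst _ _ (PowerSeries.HasSubst.of_constantCoeff_zero hF0).const]
  have hgi : ∀ i : Fin 2, h.subst (MvPowerSeries.X i : MvPowerSeries (Fin 2) (ZMod p)) =
      MvPowerSeries.expand p hp0 (g.subst (MvPowerSeries.X i : MvPowerSeries (Fin 2) (ZMod p))) := fun i ↦ by
    have e : (fun _ : Unit => (MvPowerSeries.X i : MvPowerSeries (Fin 2) (ZMod p)) ^ p) =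
        fun _ : Unit => MvPowerSeries.expand p hp0 (MvPowerSeries.X i : MvPowerSeries (Fin 2) (ZMod p)) := by
      funext; rw [MvPowerSeries.expand_X]
    rw [hg, Summit.BirchSwinnertonDyer.BirchSwinnertonDyer.Theorems.KatzFrobenius.expand_subst_eq (hX i) p hp0,
      PowerSeries.subst, PowerSeries.subst, e,
      MvPowerSeries.expand_subst _ _ (PowerSeries.HasSubst.X i).const]
  have hgA0 : MvPowerSeries.constantCoeff (g.subst (MvPowerSeries.X 0 : MvPowerSeries (Fin 2) (ZMod p))) = 0 :=
    constantCoeff_powerSeries_subst_eq_zero (hX 0) hg0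
  have hgB0 : MvPowerSeries.constantCoeff (g.subst (MvPowerSeries.X 1 : MvPowerSeries (Fin 2) (ZMod p))) = 0 :=
    constantCoeff_powerSeries_subst_eq_zero (hX 1) hg0
  have hR : MvPowerSeries.subst ![h.subst (MvPowerSeries.X 0 : MvPowerSeries (Fin 2) (ZMod p)),
        h.subst (MvPowerSeries.X 1 : MvPowerSeries (Fin 2) (ZMod p))] F =
      MvPowerSeries.expand p hp0 (MvPowerSeries.subst ![g.subst (MvPowerSeries.X 0 : MvPowerSeries (Fin 2) (ZMod p)),
        g.subst (MvPowerSeries.X 1 : MvPowerSeries (Fin 2) (ZMod p))] F) := by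
    rw [hgi 0, hgi 1]
    have e2 : (![MvPowerSeries.expand p hp0 (g.subst (MvPowerSeries.X 0 : MvPowerSeries (Fin 2) (ZMod p))),
        MvPowerSeries.expand p hp0 (g.subst (MvPowerSeries.X 1 : MvPowerSeries (Fin 2) (ZMod p)))] :
          Fin 2 → MvPowerSeries (Fin 2) (ZMod p)) =
        fun i => MvPowerSeries.expand p hp0 ((![g.subst (MvPowerSeries.X 0 : MvPowerSeries (Fin 2) (ZMod p)),
          g.subst (MvPowerSeries.X 1 : MvPowerSeries (Fin 2) (ZMod p))]) i) := by
      funext i; fin_cases i <;> rfl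
    rw [e2, MvPowerSeries.expand_subst _ _ (WeierstrassCurve.hasSubst_pair hgA0 hgB0)]
  have key : MvPowerSeries.expand p hp0 (g.subst F) =
      MvPowerSeries.expand p hp0 (MvPowerSeries.subst ![g.subst (MvPowerSeries.X 0 : MvPowerSeries (Fin 2) (ZMod p)),
        g.subst (MvPowerSeries.X 1 : MvPowerSeries (Fin 2) (ZMod p))] F) := by
    rw [← hL, ← hR]; exact hh
  -- `expand` is injective
  ext e
  have := congrArg (MvPowerSeries.coeff (p • e)) key
  rwa [MvPowerSeries.coeff_expand_smul, MvPowerSeries.coeff_expand_smul] at this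

end CharP

end Summit.BirchSwinnertonDyer.BirchSwinnertonDyer.Theorems.FormalEndomorphism
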